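import Summits.ValiantsHypothesis.ValiantsHypothesis.Theorems.GrenetZeonDualUnipotentThreeHalvesLongMassTriangular

/-!
# `GrenetZeon.DualUnipotentThreeHalves` (stmt-ValiantsHypothesis-24318), MASS-CUT line `slow_core`: ROW r7 (crit-7 V35 LEMMA P, its conclusion) — ACYCLIC SUPPORT ⇒ (c)-price `≤ 3·⌊√n⌋·m`, by RELABELLING to r2 (part 2/2; val-idea-26 g6, ported by name)

§6 ★ r7 ACYCLIC SUPPORT: `submatrix_equiv_pow`, `ledger_top_of_reindex`, `relCert_of_reindex`, `relCert_of_gradedSupport` (any strict grading of the support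
   digraph, edges RISE ⇒ `RelCert n m N (3·(⌊√n⌋·m))`, by a topological sort (Mathlib `Tuple.sort`) onto r2), ★ `relCert_of_acyclicSupport` = crit-7's TYPED r7
   SIGNATURE VERBATIM (`hlvl : B i j ≠ 0 → lvl j < lvl i`, `RelCert n b B (20 * (Nat.sqrt n * b))`), `relCert_of_acyclicSupport_three` (same orientation, constant 3),
   the `example` «`hlvl` ⇒ `SlowCore.LevelCut`», `relCert_of_values_acyclicSupport` (pointwise supports suffice), `longMass_on_acyclic_locus` (stub binder order).
§7 ★ r7 for the census's COORDINATE PATTERN PENCILS (✓ `…HeavyTopPatternDefs.patPencil`): `relCert_patPencil_of_graded` (graded placement ⇒ price ≤ 3⌊√n⌋m),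
   `relCert_patPencil_of_strictUpper`.

WORDS OF RECORD (desk #377 (B) / #380, critic of record val-idea-crit-7 g3 V27/V35): «(c)-price HOLDS on the value-space-triangularisable locus (≤ 3·√n·b)
and on the acyclic-support locus (≤ 3·√n·b, and crit-7's 20·√n·b form by name) — SUPPORT LEMMAS, V35 (α) corner; never an `IrreducibleInv` constituent;
NOT progress on (c) `LongMassSlowLawInv`, RESEARCH — OPEN».  Calibration rows (M-tier) that the registered skeleton's menu names; no law is asserted; nothing
here is claimed new (Lemma D in a finer currency).  (c) / (b) for a > 0 / S3 `SlowPlane` / R2ᵖ / 24318 / 8062 OPEN; VP ≠ VNP is NOT proved.  0 sorry.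
Port (val-lit-p3 g18, desk #379/#380 (G2)) of val-idea-26 g6's `Cruxes/DualUnipotentThreeHalves/TriangularRow.lean` REV 2.2 (sha16 25b9bb0eab33ca55, 453 l.,
0 sorry / 0 warnings) — bodies VERBATIM by name, namespace `…Cruxes.DualUnipotentThreeHalves.TriangularRow` → `…Theorems.GrenetZeon.TriangularRow`, split in two
files for the 400-line convention; lead val-port-2 (line `slow_core`).  Credit: mathematics and kernel proofs val-idea-26 g6; r7 typed signature val-idea-crit-7 g3;
`Ledger`/`RelCert` vocabulary val-idea-26 g5 / val-port-2 g3 (✓ `…SlowCoreLedger`); Lemma D♯ val-port-2 g2.  Helper (`--supports stmt-ValiantsHypothesis-24318 --as helper`).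
No instances, no notation, no named facts.
-/

set_option linter.dupNamespace false
set_option autoImplicit false

noncomputable section

namespace Summit.ValiantsHypothesis.ValiantsHypothesis.Theorems.GrenetZeon.TriangularRow

open MvPolynomial Matrix
open scoped BigOperators
open Summit.ValiantsHypothesis.ValiantsHypothesis.Cruxes.TwoDimCoefficients.DimTwoCases (AffMat IsAffine)
open Summit.ValiantsHypothesis.ValiantsHypothesis.Theorems.GrenetZeon.RadicalSplit
  (lineSubst flagDeg FlagAdapted FlagAdaptedUpTo FlagCheap card_sameBlock_pairs_le patTop patPencil patTop_apply_of_ne isAffine_patPencil)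
open Summit.ValiantsHypothesis.ValiantsHypothesis.Theorems.GrenetZeon.SlowCore
  (Slow SlowR totalDegree_pow_le_flagDeg_of_le Ledger RelCert finrank_dir_le)
open Summit.ValiantsHypothesis.ValiantsHypothesis.Theorems.GrenetZeon.FlagCost (conj_pow_eq totalDegree_conj_le)
open Summit.ValiantsHypothesis.ValiantsHypothesis.Theorems.DualUnipotentThreeHalvesNegative.FlagCost
  (coeff_aeval_line_eq_zero_of_two_le map_conj_algHom coeff_conj_apply top_map_aeval_line_eq_linPart)

/-! ## §6 Row r7 (crit-7 V35 LEMMA P, its conclusion) — ACYCLIC SUPPORT ⇒ price `≤ 3·⌊√n⌋·m`, by RELABELLING to r2 -/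

/-- Reindexing along an equivalence commutes with powers. [folklore; = `NilCouplingRow.submatrix_equiv_pow`] -/
theorem submatrix_equiv_pow {α β : Type*} [Fintype α] [Fintype β] [DecidableEq α] [DecidableEq β] {R : Type*} [CommRing R]
    (M : Matrix β β R) (e : α ≃ β) : ∀ L : ℕ, (M.submatrix e e) ^ L = (M ^ L).submatrix e e
  | 0 => by rw [pow_zero, pow_zero, Matrix.submatrix_one_equiv]
  | L + 1 => by rw [pow_succ, pow_succ, submatrix_equiv_pow M e L, Matrix.submatrix_mul_equiv]

/-- A whole-pencil ledger entry is invariant under RELABELLING the coordinates of `ℂ^m` (a permutation is a constant conjugation, cf.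
✓ `SlowCore.ledger_top_of_conj`; here directly). [this file] -/
theorem ledger_top_of_reindex {n m : ℕ} (N : AffMat n m) (σ : Equiv.Perm (Fin m)) (K : Submodule ℂ (Fin n × Fin n → ℂ)) (k : ℕ)
    (h : Ledger n m (N.submatrix σ σ) (fun _ => True) K k) : Ledger n m N (fun _ => True) K k := by
  intro x v hv b hb i j _ _
  have h1 := h x v hv b hb (σ.symm i) (σ.symm j) trivial trivial
  have hsub : (N.submatrix σ σ).map (lineSubst x v) = (N.map (lineSubst x v)).submatrix σ σ := rfl
  rwa [hsub, submatrix_equiv_pow, Matrix.submatrix_apply, Equiv.apply_symm_apply, Equiv.apply_symm_apply] at h1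

/-- Prices are invariant under relabelling. [this file] -/
theorem relCert_of_reindex {n m : ℕ} (N : AffMat n m) (σ : Equiv.Perm (Fin m)) (P : ℕ) (h : RelCert n m (N.submatrix σ σ) P) :
    RelCert n m N P := by
  obtain ⟨K, k, hK, hP⟩ := h
  exact ⟨K, k, ledger_top_of_reindex N σ K k hK, hP⟩

/-- ★ **ROW r7 — ACYCLIC SUPPORT.**  If the support digraph `{(i, j) : N i j ≠ 0}` of an affine pencil (entries constant + linear form, read as
POLYNOMIALS — coordinates may share positions, constants allowed) is ACYCLIC, witnessed by any strict grading `lvl` (`N i j ≠ 0 ⇒ lvl i < lvl j`),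
then `RelCert n m N (3·(⌊√n⌋·m))` for ALL `n, m` — nilpotency by cancellation, irreducibility, counts: none used.  Proof: sort the coordinates by
`lvl` (✓ Mathlib `Tuple.sort` / `Tuple.monotone_sort`); the relabelled pencil is strictly upper triangular; r2 ✓ `relCert_of_strictUpper` +
`relCert_of_reindex`.  = the conclusion of crit-7 V35 LEMMA P («every nil PATTERN pencil / DAG pattern space has price ≤ 3√n·b») in the kernel, via
Lemma D♯'s INDEX bands after a topological sort (V35 bands by DEPTH; same normal-form price).  By V35's consequence the Sidon-torus corner of the
closure hunt is thereby empty BY KERNEL THEOREM once `patPencil`s are fed in (their support is the pattern's). [this file; CRITIC-V35-pattern-pencils.md] -/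
theorem relCert_of_gradedSupport {n m : ℕ} (N : AffMat n m) (hN : IsAffine N) (lvl : Fin m → ℕ)
    (hacyc : ∀ i j : Fin m, N i j ≠ 0 → lvl i < lvl j) :
    RelCert n m N (3 * (Nat.sqrt n * m)) := by
  set σ : Equiv.Perm (Fin m) := Tuple.sort lvl with hσ
  have hmono : Monotone (lvl ∘ σ) := Tuple.monotone_sort lvl
  refine relCert_of_reindex N σ _
    (relCert_of_strictUpper (N.submatrix σ σ) (fun i j => hN (σ i) (σ j)) (fun i j hji => ?_))
  rw [Matrix.submatrix_apply]
  by_contra hne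
  have hlt := hacyc (σ i) (σ j) hne
  have hle : lvl (σ j) ≤ lvl (σ i) := hmono hji
  omega

/-- ★ **crit-7's TYPED ROW r7, VERBATIM** (bus 00:21:04Z; desk #376/#377 hand-1 file `…LongMassAcyclic` / `…LongMassTriangular`): orientation of the
line's `LevelCut` (edges DROP in level: `B i j ≠ 0 ⇒ lvl j < lvl i`), SAFE constant `20`.  Corollary of `relCert_of_gradedSupport` (reverse the grading by
`i ↦ S − lvl i`, `S = sup lvl`) and `relCert_mono` (`3 ≤ 20`).  «(c)-price holds on the ACYCLIC-SUPPORT class — support lemma, not progress on (c).»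
[this file; crit-7 g3 R328 (3) typing] -/
theorem relCert_of_acyclicSupport {n b : ℕ} (B : AffMat n b) (hB : IsAffine B) (lvl : Fin b → ℕ)
    (hlvl : ∀ i j, B i j ≠ 0 → lvl j < lvl i) : RelCert n b B (20 * (Nat.sqrt n * b)) :=
  relCert_mono (relCert_of_acyclicSupport_three_aux B hB lvl hlvl) (Nat.mul_le_mul_right _ (by norm_num))
where
  /-- the constant-3 form in the `LevelCut` orientation -/
  relCert_of_acyclicSupport_three_aux {n b : ℕ} (B : AffMat n b) (hB : IsAffine B) (lvl : Fin b → ℕ)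
      (hlvl : ∀ i j, B i j ≠ 0 → lvl j < lvl i) : RelCert n b B (3 * (Nat.sqrt n * b)) := by
    refine relCert_of_gradedSupport B hB (fun i => Finset.univ.sup lvl - lvl i) (fun i j hne => ?_)
    have h1 := hlvl i j hne
    have hi : lvl i ≤ Finset.univ.sup lvl := Finset.le_sup (f := lvl) (Finset.mem_univ i)
    have hj : lvl j ≤ Finset.univ.sup lvl := Finset.le_sup (f := lvl) (Finset.mem_univ j)
    show Finset.univ.sup lvl - lvl i < Finset.univ.sup lvl - lvl j
    omega

/-- The constant-3 form in the `LevelCut` orientation (edges DROP in level). [this file] -/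
theorem relCert_of_acyclicSupport_three {n b : ℕ} (B : AffMat n b) (hB : IsAffine B) (lvl : Fin b → ℕ)
    (hlvl : ∀ i j, B i j ≠ 0 → lvl j < lvl i) : RelCert n b B (3 * (Nat.sqrt n * b)) :=
  relCert_of_acyclicSupport.relCert_of_acyclicSupport_three_aux B hB lvl hlvl

/-- `hlvl` in the DROP orientation is exactly a STRICT `SlowCore.LevelCut` (the weak cut `LevelCut B lvl` follows). [sanity, this file] -/
example {n b : ℕ} (B : AffMat n b) (lvl : Fin b → ℕ) (hlvl : ∀ i j, B i j ≠ 0 → lvl j < lvl i) :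
    Summit.ValiantsHypothesis.ValiantsHypothesis.Theorems.GrenetZeon.SlowCore.LevelCut B lvl := by
  intro i j hij
  by_contra hne
  have := hlvl i j hne
  omega

/-- **Digraph form.**  The same with acyclicity given by ANY function `lvl` into a linear order?  We keep `ℕ`-gradings: a finite digraph is acyclic
iff it admits one (depth).  POINTWISE variant: it suffices that the support of every VALUE `N(y)` lies in one `lvl`-graded pattern. [this file] -/
theorem relCert_of_values_acyclicSupport {n m : ℕ} (N : AffMat n m) (hN : IsAffine N) (lvl : Fin m → ℕ)
    (hacyc : ∀ y : Fin n × Fin n → ℂ, ∀ i j : Fin m, (N.map (MvPolynomial.eval y)) i j ≠ 0 → lvl i < lvl j) :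
    RelCert n m N (3 * (Nat.sqrt n * m)) := by
  refine relCert_of_gradedSupport N hN lvl (fun i j hne => ?_)
  by_contra hge
  apply hne
  apply MvPolynomial.funext
  intro y
  rw [map_zero]
  by_contra hy
  exact hge (hacyc y i j (by rwa [Matrix.map_apply]))

/-- **(c) ON THE ACYCLIC-SUPPORT LOCUS** (row r7), in the stub's binder order with `c = 3`, `n₀ = 0`. [this file; §6] -/
theorem longMass_on_acyclic_locus :
    ∀ n b : ℕ, ∀ B : AffMat n b, IsAffine B →
      (∃ lvl : Fin b → ℕ, ∀ i j : Fin b, B i j ≠ 0 → lvl i < lvl j) → RelCert n b B (3 * (Nat.sqrt n * b)) := by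
  intro n b B hB hlvl
  obtain ⟨lvl, hacyc⟩ := hlvl
  exact relCert_of_gradedSupport B hB lvl hacyc

/-! ## §7 Row r7 for the census's COORDINATE PATTERN PENCILS (✓ `…HeavyTopPatternDefs.patPencil`) -/

/-- ★ **r7 FOR `patPencil`.**  A placement `pos : coordinates → positions` whose pattern digraph is graded (`lvl (pos c).1 < lvl (pos c).2` for every
coordinate `c`; coordinates may share positions, `pos` need not be injective) gives a pattern pencil of price `≤ 3·⌊√n⌋·m`, for ALL `n, m`.  With
V35's remark (a NIL pattern pencil has acyclic support, by ✓ Lemma B «no cancellation on paths») this is «every nil pattern pencil is (c)-cheap»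
modulo that one typing step (htc's / the port's). [this file; CRITIC-V35 LEMMA P] -/
theorem relCert_patPencil_of_graded {n m : ℕ} (pos : Fin n × Fin n → Fin m × Fin m) (lvl : Fin m → ℕ)
    (hacyc : ∀ c, lvl (pos c).1 < lvl (pos c).2) : RelCert n m (patPencil pos) (3 * (Nat.sqrt n * m)) := by
  refine relCert_of_gradedSupport (patPencil pos) (isAffine_patPencil pos) lvl (fun i j hne => ?_)
  by_contra hge
  apply hne
  show patTop pos _ i j = 0
  exact patTop_apply_of_ne pos _ fun c hc => hge (by have h := hacyc c; rwa [hc] at h)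

/-- In particular (`lvl = id`): a strictly upper placement (`(pos c).1 < (pos c).2`, the census's nil instances `patPencil_strictUpper`) has price
`≤ 3·⌊√n⌋·m` — the grid's triangular boundary `m*_tri` in `RelCert` currency, cell-free. [this file] -/
theorem relCert_patPencil_of_strictUpper {n m : ℕ} (pos : Fin n × Fin n → Fin m × Fin m) (hup : ∀ c, (pos c).1 < (pos c).2) :
    RelCert n m (patPencil pos) (3 * (Nat.sqrt n * m)) :=
  relCert_patPencil_of_graded pos (fun i => (i : ℕ)) fun c => Fin.lt_def.1 (hup c)


end Summit.ValiantsHypothesis.ValiantsHypothesis.Theorems.GrenetZeon.TriangularRow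

end
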